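import Mathlib
import HarnessLib
import Summits.Ventures.LatticeQCDFlow.Exactness.IMHColdStartBurnIn
import Summits.Ventures.LatticeQCDFlow.Scaling.AutoregressiveGaugeAllClosingColdExact

/-!
# LatticeQCDFlow / Scaling — the exact burn-in law of the cold-started all-closing conditioner:
# time averages forget the cold configuration like `∏_ℓ c_{#C_ℓ}/(Z·N)`

HONEST FRAMING: exact (Metropolis-corrected) sampling algorithms for lattice gauge theory;
figures of merit are autocorrelation/cost numbers at stated couplings and volumes; no
continuum-physics claim.

Venture `LatticeQCDFlow` (cell pub-lqcd), topic `Scaling`, FANOUT row 30 (lean-1, GEN-31) — OUR WORK, the gauge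
instance of `Exactness/IMHColdStartBurnIn` (this generation; sibling of `AutoregressiveGaugeAllClosingColdLaw`).  Setting:
`L ≥ 2`; `w` continuous, `0 < m ≤ w ≤ M`, `w(g⁻¹) = w(g)`; `(T, C)` a closing assignment; target
`π = (F/Z)·Haar^{⊗E}`, proposal `q = (∏_ℓ F_{C_ℓ}/N_ℓ)·Haar^{⊗E}`, exact sampler `K = indepMH q (∏_ℓ N_ℓ/Z)`, cold
acceptance `A = Z/∏_ℓ c_{#C_ℓ}` (GEN-28 `allClosing_cold_acceptMass_eq`).  The cold configuration is the
mode of the importance weight, whose normalised value there is `1/A`; a practitioner who starts the exact sampler cold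
and AVERAGES the first `N` configurations of ANY `π`-integrable observable `f` (plaquette, Wilson loop, action, …)
incurs a bias that is known EXACTLY:

* **`allClosing_coldStart_burnIn`** — `Σ_{n<N} (E_cold f(U_n) − π f) = (f(cold) − π f)·(1/A)·(1 − (1 − A)^N)`.
* **`allClosing_coldStart_burnIn_two_sided`** — `|f(cold) − π f|·N/(1 + N·A) ≤ |Σ_{n<N} bias_n| ≤ |f(cold) − π f|·min(N, 1/A)`:
  the time-average bias is `|f(cold) − π f|/(1 + N·A)` within a factor `2` — it decays like `∏_ℓ c_{#C_ℓ}/Z` over `N`,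
  NOT geometrically.
* **`allClosing_burnIn_sufficient`** — `N·ε ≥ 1/A` ⇒ time-average bias `≤ ε·|f(cold) − π f|` for EVERY observable;
  **`allClosing_burnIn_necessary`** — if some observable with `f(cold) ≠ π f` has time-average bias
  `≤ ε·|f(cold) − π f|` over a run of length `N ≥ 1`, then `(1 − ε)/A ≤ ε·N`.  THE COLD-START BURN-IN OF THE EXACT
  SAMPLER IS `∏_ℓ c_{#C_ℓ}/Z` `· 1/ε` STEPS up to the factor `1 − ε`: polynomial in `1/ε` (the ε-mixing time of
  GEN-28 `AutoregressiveGaugeMixingTimeWindow` is the same scale times `log(1/ε)`), and — through GEN-28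
  `AutoregressiveGaugeColdEscapeDimension` — bounded by `(M/m)/ε` for every `L` on `(ℤ/L)²` along an optimal
  structure, at least `(1 − ε)θ₁^{−s}/ε` with `(2(d−1)−1)s ≥ k_min` in every dimension (exponential in `L³` for `d = 3`).

NOT CLAIMED: the variance / mean-square error of the time average (two-time laws); non-cold starts; the size of `Z`.
No `def`, no `sorry`, nothing cited as a fact beyond the tree.
-/

noncomputable section

namespace Summit.Ventures.LatticeQCDFlow.Theory2.Autoregressive

open MeasureTheory ProbabilityTheory Function Finset
open scoped ENNReal
open Literature.MathematicalPhysics.QuantumFieldTheory Literature.MathematicalPhysics.QuantumLattice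
open Summit.Ventures.LatticeQCDFlow.Exactness Summit.Ventures.LatticeQCDFlow.Scoring

variable {d L : ℕ} [NeZero L] {G : Type*} [Group G] [TopologicalSpace G] [IsTopologicalGroup G]
  [CompactSpace G] [SecondCountableTopology G] [MeasurableSpace G] [BorelSpace G]

/-- **THE EXACT BURN-IN LAW** of the cold-started exact sampler: for every `π`-integrable `f` and every `N`,
`Σ_{n<N} (E_cold f(U_n) − π f) = (f(cold) − π f)·(1/A)·(1 − (1 − A)^N)`, `A = Z/∏_{ℓ∈T} c_{#C_ℓ}`. [ours] -/
theorem allClosing_coldStart_burnIn [MeasurableSingletonClass G] (hL : 2 ≤ L) {w : G → ℝ} (hw : Continuous w) {m M : ℝ} (hm0 : 0 < m)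
    (hm : ∀ g, m ≤ w g) (hM : ∀ g, w g ≤ M) (hwinv : ∀ g, w g⁻¹ = w g)
    (T : Finset (Edge d L)) (C : Edge d L → Finset (Plaquette d L))
    (hCne : ∀ ℓ ∈ T, (C ℓ).Nonempty)
    (hCe : ∀ ℓ ∈ T, ∀ p ∈ C ℓ, ℓ ∈ ({(p.1, p.2.1.1), (p.1.shift p.2.1.1, p.2.1.2),
        (p.1.shift p.2.1.2, p.2.1.1), (p.1, p.2.1.2)} : Finset (Edge d L)))
    (hdisj : ∀ ℓ ∈ T, ∀ ℓ' ∈ T, ℓ ≠ ℓ' → Disjoint (C ℓ) (C ℓ'))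
    (hcover : ∀ p : Plaquette d L, ∃ ℓ ∈ T, p ∈ C ℓ)
    (π q : Measure (GaugeConfig d L G)) [IsProbabilityMeasure π] [IsProbabilityMeasure q]
    (hπ : π = (Measure.pi fun _ : Edge d L => haarProbability G).withDensity fun U =>
      ENNReal.ofReal ((∏ p : Plaquette d L, w (plaquetteHolonomy U p.1 p.2.1.1 p.2.1.2)) /
        ∫ V, ∏ p : Plaquette d L, w (plaquetteHolonomy V p.1 p.2.1.1 p.2.1.2) ∂(Measure.pi fun _ : Edge d L => haarProbability G)))
    (hq : q = (Measure.pi fun _ : Edge d L => haarProbability G).withDensity fun U =>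
      ENNReal.ofReal (∏ ℓ ∈ T, (∏ p ∈ C ℓ, w (plaquetteHolonomy U p.1 p.2.1.1 p.2.1.2)) /
          (∫ v, ∏ p ∈ C ℓ, w (plaquetteHolonomy (update U ℓ v) p.1 p.2.1.1 p.2.1.2) ∂(haarProbability G)))) (N : ℕ)
    {f : GaugeConfig d L G → ℝ} (hf : Integrable f π) :
    ∑ n ∈ Finset.range N, (∫ U, f U ∂((fun ν : Measure (GaugeConfig d L G) => ν.bind (indepMH q fun U =>
        (((∫ V, ∏ p : Plaquette d L, w (plaquetteHolonomy V p.1 p.2.1.1 p.2.1.2) ∂(Measure.pi fun _ : Edge d L => haarProbability G)) /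
          ∏ ℓ ∈ T, (∫ v, ∏ p ∈ C ℓ, w (plaquetteHolonomy (update U ℓ v) p.1 p.2.1.1 p.2.1.2) ∂(haarProbability G))))⁻¹))^[n]
        (Measure.dirac (fun _ : Edge d L => (1 : G)))) - ∫ U, f U ∂π) =
      (f (fun _ : Edge d L => (1 : G)) - ∫ U, f U ∂π) *
        (((∫ V, ∏ p : Plaquette d L, w (plaquetteHolonomy V p.1 p.2.1.1 p.2.1.2) ∂(Measure.pi fun _ : Edge d L => haarProbability G)) /
        ∏ ℓ ∈ T, ∫ h, w h ^ (C ℓ).card ∂(haarProbability G))⁻¹ *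
          (1 - (1 - (∫ V, ∏ p : Plaquette d L, w (plaquetteHolonomy V p.1 p.2.1.1 p.2.1.2) ∂(Measure.pi fun _ : Edge d L => haarProbability G)) /
        ∏ ℓ ∈ T, ∫ h, w h ^ (C ℓ).card ∂(haarProbability G)) ^ N)) := by
  obtain ⟨hA, hρq, hmax, hρm, hρpos⟩ := allClosing_cold_acceptMass_eq hL hw hm0 hm hM hwinv T C hCne hCe hdisj hcover π q hπ hq
  set cold : GaugeConfig d L G := fun _ => (1 : G) with hcold
  set ρ : GaugeConfig d L G → ℝ := fun U =>
    (∫ V, ∏ p : Plaquette d L, w (plaquetteHolonomy V p.1 p.2.1.1 p.2.1.2) ∂(Measure.pi fun _ : Edge d L => haarProbability G)) /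
      ∏ ℓ ∈ T, (∫ v, ∏ p ∈ C ℓ, w (plaquetteHolonomy (update U ℓ v) p.1 p.2.1.1 p.2.1.2) ∂(haarProbability G)) with hρ
  have hwm : Measurable fun U => (ρ U)⁻¹ := hρm.inv
  have hw0' : ∀ U, 0 < (ρ U)⁻¹ := fun U => inv_pos.2 (hρpos U)
  have hπ' : (q.withDensity fun U => ENNReal.ofReal (ρ U)⁻¹) = π := withDensity_inv_density hρm hρpos hρq
  haveI : IsProbabilityMeasure (q.withDensity fun U => ENNReal.ofReal (ρ U)⁻¹) := by rw [hπ']; infer_instance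
  have hone : ∫⁻ y, ENNReal.ofReal (ρ y)⁻¹ ∂q = ENNReal.ofReal 1 := by
    have h : π Set.univ = 1 := measure_univ
    rw [← hπ', withDensity_apply _ MeasurableSet.univ, Measure.restrict_univ] at h
    rw [h, ENNReal.ofReal_one]
  have hA' := imhAcceptMass_toReal_eq_of_forall_le (q := q) hw0' cold hmax zero_le_one hone
  have hrate : ((ρ cold)⁻¹)⁻¹ = (∫ V, ∏ p : Plaquette d L, w (plaquetteHolonomy V p.1 p.2.1.1 p.2.1.2) ∂(Measure.pi fun _ : Edge d L => haarProbability G)) /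
        ∏ ℓ ∈ T, ∫ h, w h ^ (C ℓ).card ∂(haarProbability G) := by
    rw [← hA, hA', one_div]
  have hrate' : (ρ cold)⁻¹ = ((∫ V, ∏ p : Plaquette d L, w (plaquetteHolonomy V p.1 p.2.1.1 p.2.1.2) ∂(Measure.pi fun _ : Edge d L => haarProbability G)) /
        ∏ ℓ ∈ T, ∫ h, w h ^ (C ℓ).card ∂(haarProbability G))⁻¹ := by
    rw [← hrate, inv_inv]
  have hf' : Integrable f (q.withDensity fun U => ENNReal.ofReal (ρ U)⁻¹) := by rw [hπ']; exact hf
  have h := sum_integral_iterate_bind_indepMH_dirac_mode_sub_eq_weight (q := q) hwm hw0' hmax N hf'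
  rw [hπ', hrate, hrate'] at h
  exact h

/-- **TWO-SIDED**: `|f(cold) − π f|·N/(1 + N·A) ≤ |Σ_{n<N} (E_cold f(U_n) − π f)| ≤ |f(cold) − π f|·min(N, 1/A)` — the
time-average bias of a cold-started run of length `N` is `|f(cold) − π f|/(1 + N·A)` within a factor `2`. [ours] -/
theorem allClosing_coldStart_burnIn_two_sided [MeasurableSingletonClass G] (hL : 2 ≤ L) {w : G → ℝ} (hw : Continuous w) {m M : ℝ} (hm0 : 0 < m)
    (hm : ∀ g, m ≤ w g) (hM : ∀ g, w g ≤ M) (hwinv : ∀ g, w g⁻¹ = w g)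
    (T : Finset (Edge d L)) (C : Edge d L → Finset (Plaquette d L))
    (hCne : ∀ ℓ ∈ T, (C ℓ).Nonempty)
    (hCe : ∀ ℓ ∈ T, ∀ p ∈ C ℓ, ℓ ∈ ({(p.1, p.2.1.1), (p.1.shift p.2.1.1, p.2.1.2),
        (p.1.shift p.2.1.2, p.2.1.1), (p.1, p.2.1.2)} : Finset (Edge d L)))
    (hdisj : ∀ ℓ ∈ T, ∀ ℓ' ∈ T, ℓ ≠ ℓ' → Disjoint (C ℓ) (C ℓ'))
    (hcover : ∀ p : Plaquette d L, ∃ ℓ ∈ T, p ∈ C ℓ)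
    (π q : Measure (GaugeConfig d L G)) [IsProbabilityMeasure π] [IsProbabilityMeasure q]
    (hπ : π = (Measure.pi fun _ : Edge d L => haarProbability G).withDensity fun U =>
      ENNReal.ofReal ((∏ p : Plaquette d L, w (plaquetteHolonomy U p.1 p.2.1.1 p.2.1.2)) /
        ∫ V, ∏ p : Plaquette d L, w (plaquetteHolonomy V p.1 p.2.1.1 p.2.1.2) ∂(Measure.pi fun _ : Edge d L => haarProbability G)))
    (hq : q = (Measure.pi fun _ : Edge d L => haarProbability G).withDensity fun U =>
      ENNReal.ofReal (∏ ℓ ∈ T, (∏ p ∈ C ℓ, w (plaquetteHolonomy U p.1 p.2.1.1 p.2.1.2)) /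
          (∫ v, ∏ p ∈ C ℓ, w (plaquetteHolonomy (update U ℓ v) p.1 p.2.1.1 p.2.1.2) ∂(haarProbability G)))) (N : ℕ)
    {f : GaugeConfig d L G → ℝ} (hf : Integrable f π) :
    |f (fun _ : Edge d L => (1 : G)) - ∫ U, f U ∂π| *
        (N / (1 + N * ((∫ V, ∏ p : Plaquette d L, w (plaquetteHolonomy V p.1 p.2.1.1 p.2.1.2) ∂(Measure.pi fun _ : Edge d L => haarProbability G)) /
        ∏ ℓ ∈ T, ∫ h, w h ^ (C ℓ).card ∂(haarProbability G)))) ≤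
      |∑ n ∈ Finset.range N, (∫ U, f U ∂((fun ν : Measure (GaugeConfig d L G) => ν.bind (indepMH q fun U =>
        (((∫ V, ∏ p : Plaquette d L, w (plaquetteHolonomy V p.1 p.2.1.1 p.2.1.2) ∂(Measure.pi fun _ : Edge d L => haarProbability G)) /
          ∏ ℓ ∈ T, (∫ v, ∏ p ∈ C ℓ, w (plaquetteHolonomy (update U ℓ v) p.1 p.2.1.1 p.2.1.2) ∂(haarProbability G))))⁻¹))^[n]
        (Measure.dirac (fun _ : Edge d L => (1 : G)))) - ∫ U, f U ∂π)| ∧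
    |∑ n ∈ Finset.range N, (∫ U, f U ∂((fun ν : Measure (GaugeConfig d L G) => ν.bind (indepMH q fun U =>
        (((∫ V, ∏ p : Plaquette d L, w (plaquetteHolonomy V p.1 p.2.1.1 p.2.1.2) ∂(Measure.pi fun _ : Edge d L => haarProbability G)) /
          ∏ ℓ ∈ T, (∫ v, ∏ p ∈ C ℓ, w (plaquetteHolonomy (update U ℓ v) p.1 p.2.1.1 p.2.1.2) ∂(haarProbability G))))⁻¹))^[n]
        (Measure.dirac (fun _ : Edge d L => (1 : G)))) - ∫ U, f U ∂π)| ≤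
      |f (fun _ : Edge d L => (1 : G)) - ∫ U, f U ∂π| *
        min (N : ℝ) ((∫ V, ∏ p : Plaquette d L, w (plaquetteHolonomy V p.1 p.2.1.1 p.2.1.2) ∂(Measure.pi fun _ : Edge d L => haarProbability G)) /
        ∏ ℓ ∈ T, ∫ h, w h ^ (C ℓ).card ∂(haarProbability G))⁻¹ := by
  obtain ⟨hA, hρq, hmax, hρm, hρpos⟩ := allClosing_cold_acceptMass_eq hL hw hm0 hm hM hwinv T C hCne hCe hdisj hcover π q hπ hq
  set cold : GaugeConfig d L G := fun _ => (1 : G) with hcold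
  set ρ : GaugeConfig d L G → ℝ := fun U =>
    (∫ V, ∏ p : Plaquette d L, w (plaquetteHolonomy V p.1 p.2.1.1 p.2.1.2) ∂(Measure.pi fun _ : Edge d L => haarProbability G)) /
      ∏ ℓ ∈ T, (∫ v, ∏ p ∈ C ℓ, w (plaquetteHolonomy (update U ℓ v) p.1 p.2.1.1 p.2.1.2) ∂(haarProbability G)) with hρ
  have hwm : Measurable fun U => (ρ U)⁻¹ := hρm.inv
  have hw0' : ∀ U, 0 < (ρ U)⁻¹ := fun U => inv_pos.2 (hρpos U)
  have hπ' : (q.withDensity fun U => ENNReal.ofReal (ρ U)⁻¹) = π := withDensity_inv_density hρm hρpos hρq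
  haveI : IsProbabilityMeasure (q.withDensity fun U => ENNReal.ofReal (ρ U)⁻¹) := by rw [hπ']; infer_instance
  have hone : ∫⁻ y, ENNReal.ofReal (ρ y)⁻¹ ∂q = ENNReal.ofReal 1 := by
    have h : π Set.univ = 1 := measure_univ
    rw [← hπ', withDensity_apply _ MeasurableSet.univ, Measure.restrict_univ] at h
    rw [h, ENNReal.ofReal_one]
  have hA' := imhAcceptMass_toReal_eq_of_forall_le (q := q) hw0' cold hmax zero_le_one hone
  have hrate : ((ρ cold)⁻¹)⁻¹ = (∫ V, ∏ p : Plaquette d L, w (plaquetteHolonomy V p.1 p.2.1.1 p.2.1.2) ∂(Measure.pi fun _ : Edge d L => haarProbability G)) /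
        ∏ ℓ ∈ T, ∫ h, w h ^ (C ℓ).card ∂(haarProbability G) := by
    rw [← hA, hA', one_div]
  have hrate' : (ρ cold)⁻¹ = ((∫ V, ∏ p : Plaquette d L, w (plaquetteHolonomy V p.1 p.2.1.1 p.2.1.2) ∂(Measure.pi fun _ : Edge d L => haarProbability G)) /
        ∏ ℓ ∈ T, ∫ h, w h ^ (C ℓ).card ∂(haarProbability G))⁻¹ := by
    rw [← hrate, inv_inv]
  have hf' : Integrable f (q.withDensity fun U => ENNReal.ofReal (ρ U)⁻¹) := by rw [hπ']; exact hf
  refine ⟨?_, ?_⟩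
  · have h := abs_sum_bias_mode_ge (q := q) hwm hw0' hmax N hf'
    rw [hπ', hrate] at h
    exact h
  · have h := abs_sum_bias_mode_le (q := q) hwm hw0' hmax N hf'
    rw [hπ', hrate'] at h
    exact h

/-- **SUFFICIENT BURN-IN**: if `N·ε ≥ 1/A` then the time-average bias of EVERY `π`-integrable observable over the
first `N` steps from the cold start is at most `ε·|f(cold) − π f|` (summed form). [ours] -/
theorem allClosing_burnIn_sufficient [MeasurableSingletonClass G] (hL : 2 ≤ L) {w : G → ℝ} (hw : Continuous w) {m M : ℝ} (hm0 : 0 < m)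
    (hm : ∀ g, m ≤ w g) (hM : ∀ g, w g ≤ M) (hwinv : ∀ g, w g⁻¹ = w g)
    (T : Finset (Edge d L)) (C : Edge d L → Finset (Plaquette d L))
    (hCne : ∀ ℓ ∈ T, (C ℓ).Nonempty)
    (hCe : ∀ ℓ ∈ T, ∀ p ∈ C ℓ, ℓ ∈ ({(p.1, p.2.1.1), (p.1.shift p.2.1.1, p.2.1.2),
        (p.1.shift p.2.1.2, p.2.1.1), (p.1, p.2.1.2)} : Finset (Edge d L)))
    (hdisj : ∀ ℓ ∈ T, ∀ ℓ' ∈ T, ℓ ≠ ℓ' → Disjoint (C ℓ) (C ℓ'))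
    (hcover : ∀ p : Plaquette d L, ∃ ℓ ∈ T, p ∈ C ℓ)
    (π q : Measure (GaugeConfig d L G)) [IsProbabilityMeasure π] [IsProbabilityMeasure q]
    (hπ : π = (Measure.pi fun _ : Edge d L => haarProbability G).withDensity fun U =>
      ENNReal.ofReal ((∏ p : Plaquette d L, w (plaquetteHolonomy U p.1 p.2.1.1 p.2.1.2)) /
        ∫ V, ∏ p : Plaquette d L, w (plaquetteHolonomy V p.1 p.2.1.1 p.2.1.2) ∂(Measure.pi fun _ : Edge d L => haarProbability G)))
    (hq : q = (Measure.pi fun _ : Edge d L => haarProbability G).withDensity fun U =>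
      ENNReal.ofReal (∏ ℓ ∈ T, (∏ p ∈ C ℓ, w (plaquetteHolonomy U p.1 p.2.1.1 p.2.1.2)) /
          (∫ v, ∏ p ∈ C ℓ, w (plaquetteHolonomy (update U ℓ v) p.1 p.2.1.1 p.2.1.2) ∂(haarProbability G)))) {N : ℕ} {ε : ℝ}
    (hN : ((∫ V, ∏ p : Plaquette d L, w (plaquetteHolonomy V p.1 p.2.1.1 p.2.1.2) ∂(Measure.pi fun _ : Edge d L => haarProbability G)) /
        ∏ ℓ ∈ T, ∫ h, w h ^ (C ℓ).card ∂(haarProbability G))⁻¹ ≤ N * ε)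
    {f : GaugeConfig d L G → ℝ} (hf : Integrable f π) :
    |∑ n ∈ Finset.range N, (∫ U, f U ∂((fun ν : Measure (GaugeConfig d L G) => ν.bind (indepMH q fun U =>
        (((∫ V, ∏ p : Plaquette d L, w (plaquetteHolonomy V p.1 p.2.1.1 p.2.1.2) ∂(Measure.pi fun _ : Edge d L => haarProbability G)) /
          ∏ ℓ ∈ T, (∫ v, ∏ p ∈ C ℓ, w (plaquetteHolonomy (update U ℓ v) p.1 p.2.1.1 p.2.1.2) ∂(haarProbability G))))⁻¹))^[n]
        (Measure.dirac (fun _ : Edge d L => (1 : G)))) - ∫ U, f U ∂π)| ≤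
      ε * N * |f (fun _ : Edge d L => (1 : G)) - ∫ U, f U ∂π| := by
  obtain ⟨hA, hρq, hmax, hρm, hρpos⟩ := allClosing_cold_acceptMass_eq hL hw hm0 hm hM hwinv T C hCne hCe hdisj hcover π q hπ hq
  set cold : GaugeConfig d L G := fun _ => (1 : G) with hcold
  set ρ : GaugeConfig d L G → ℝ := fun U =>
    (∫ V, ∏ p : Plaquette d L, w (plaquetteHolonomy V p.1 p.2.1.1 p.2.1.2) ∂(Measure.pi fun _ : Edge d L => haarProbability G)) /
      ∏ ℓ ∈ T, (∫ v, ∏ p ∈ C ℓ, w (plaquetteHolonomy (update U ℓ v) p.1 p.2.1.1 p.2.1.2) ∂(haarProbability G)) with hρ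
  have hwm : Measurable fun U => (ρ U)⁻¹ := hρm.inv
  have hw0' : ∀ U, 0 < (ρ U)⁻¹ := fun U => inv_pos.2 (hρpos U)
  have hπ' : (q.withDensity fun U => ENNReal.ofReal (ρ U)⁻¹) = π := withDensity_inv_density hρm hρpos hρq
  haveI : IsProbabilityMeasure (q.withDensity fun U => ENNReal.ofReal (ρ U)⁻¹) := by rw [hπ']; infer_instance
  have hone : ∫⁻ y, ENNReal.ofReal (ρ y)⁻¹ ∂q = ENNReal.ofReal 1 := by
    have h : π Set.univ = 1 := measure_univ
    rw [← hπ', withDensity_apply _ MeasurableSet.univ, Measure.restrict_univ] at h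
    rw [h, ENNReal.ofReal_one]
  have hA' := imhAcceptMass_toReal_eq_of_forall_le (q := q) hw0' cold hmax zero_le_one hone
  have hrate : ((ρ cold)⁻¹)⁻¹ = (∫ V, ∏ p : Plaquette d L, w (plaquetteHolonomy V p.1 p.2.1.1 p.2.1.2) ∂(Measure.pi fun _ : Edge d L => haarProbability G)) /
        ∏ ℓ ∈ T, ∫ h, w h ^ (C ℓ).card ∂(haarProbability G) := by
    rw [← hA, hA', one_div]
  have hrate' : (ρ cold)⁻¹ = ((∫ V, ∏ p : Plaquette d L, w (plaquetteHolonomy V p.1 p.2.1.1 p.2.1.2) ∂(Measure.pi fun _ : Edge d L => haarProbability G)) /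
        ∏ ℓ ∈ T, ∫ h, w h ^ (C ℓ).card ∂(haarProbability G))⁻¹ := by
    rw [← hrate, inv_inv]
  have hf' : Integrable f (q.withDensity fun U => ENNReal.ofReal (ρ U)⁻¹) := by rw [hπ']; exact hf
  have hN' : (ρ cold)⁻¹ ≤ N * ε := by rw [hrate']; exact hN
  have h := sum_bias_mode_le_of_weight_le (q := q) hwm hw0' hmax hN' hf'
  rw [hπ'] at h
  exact h

/-- **NECESSARY BURN-IN**: if for some `π`-integrable observable with `f(cold) ≠ π f` the time-average bias over a
cold-started run of length `N ≥ 1` is at most `ε·|f(cold) − π f|`, then `(1 − ε)/A ≤ ε·N` — the burn-in is `1/(εA)`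
steps up to the factor `1 − ε`. [ours] -/
theorem allClosing_burnIn_necessary [MeasurableSingletonClass G] (hL : 2 ≤ L) {w : G → ℝ} (hw : Continuous w) {m M : ℝ} (hm0 : 0 < m)
    (hm : ∀ g, m ≤ w g) (hM : ∀ g, w g ≤ M) (hwinv : ∀ g, w g⁻¹ = w g)
    (T : Finset (Edge d L)) (C : Edge d L → Finset (Plaquette d L))
    (hCne : ∀ ℓ ∈ T, (C ℓ).Nonempty)
    (hCe : ∀ ℓ ∈ T, ∀ p ∈ C ℓ, ℓ ∈ ({(p.1, p.2.1.1), (p.1.shift p.2.1.1, p.2.1.2),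
        (p.1.shift p.2.1.2, p.2.1.1), (p.1, p.2.1.2)} : Finset (Edge d L)))
    (hdisj : ∀ ℓ ∈ T, ∀ ℓ' ∈ T, ℓ ≠ ℓ' → Disjoint (C ℓ) (C ℓ'))
    (hcover : ∀ p : Plaquette d L, ∃ ℓ ∈ T, p ∈ C ℓ)
    (π q : Measure (GaugeConfig d L G)) [IsProbabilityMeasure π] [IsProbabilityMeasure q]
    (hπ : π = (Measure.pi fun _ : Edge d L => haarProbability G).withDensity fun U =>
      ENNReal.ofReal ((∏ p : Plaquette d L, w (plaquetteHolonomy U p.1 p.2.1.1 p.2.1.2)) /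
        ∫ V, ∏ p : Plaquette d L, w (plaquetteHolonomy V p.1 p.2.1.1 p.2.1.2) ∂(Measure.pi fun _ : Edge d L => haarProbability G)))
    (hq : q = (Measure.pi fun _ : Edge d L => haarProbability G).withDensity fun U =>
      ENNReal.ofReal (∏ ℓ ∈ T, (∏ p ∈ C ℓ, w (plaquetteHolonomy U p.1 p.2.1.1 p.2.1.2)) /
          (∫ v, ∏ p ∈ C ℓ, w (plaquetteHolonomy (update U ℓ v) p.1 p.2.1.1 p.2.1.2) ∂(haarProbability G)))) {N : ℕ} (hN : 0 < N)
    {ε : ℝ} {f : GaugeConfig d L G → ℝ} (hf : Integrable f π)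
    (hfx : f (fun _ : Edge d L => (1 : G)) ≠ ∫ U, f U ∂π)
    (hbias : |∑ n ∈ Finset.range N, (∫ U, f U ∂((fun ν : Measure (GaugeConfig d L G) => ν.bind (indepMH q fun U =>
        (((∫ V, ∏ p : Plaquette d L, w (plaquetteHolonomy V p.1 p.2.1.1 p.2.1.2) ∂(Measure.pi fun _ : Edge d L => haarProbability G)) /
          ∏ ℓ ∈ T, (∫ v, ∏ p ∈ C ℓ, w (plaquetteHolonomy (update U ℓ v) p.1 p.2.1.1 p.2.1.2) ∂(haarProbability G))))⁻¹))^[n]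
        (Measure.dirac (fun _ : Edge d L => (1 : G)))) - ∫ U, f U ∂π)| ≤
      ε * N * |f (fun _ : Edge d L => (1 : G)) - ∫ U, f U ∂π|) :
    ((∫ V, ∏ p : Plaquette d L, w (plaquetteHolonomy V p.1 p.2.1.1 p.2.1.2) ∂(Measure.pi fun _ : Edge d L => haarProbability G)) /
        ∏ ℓ ∈ T, ∫ h, w h ^ (C ℓ).card ∂(haarProbability G))⁻¹ * (1 - ε) ≤ ε * N := by
  obtain ⟨hA, hρq, hmax, hρm, hρpos⟩ := allClosing_cold_acceptMass_eq hL hw hm0 hm hM hwinv T C hCne hCe hdisj hcover π q hπ hq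
  set cold : GaugeConfig d L G := fun _ => (1 : G) with hcold
  set ρ : GaugeConfig d L G → ℝ := fun U =>
    (∫ V, ∏ p : Plaquette d L, w (plaquetteHolonomy V p.1 p.2.1.1 p.2.1.2) ∂(Measure.pi fun _ : Edge d L => haarProbability G)) /
      ∏ ℓ ∈ T, (∫ v, ∏ p ∈ C ℓ, w (plaquetteHolonomy (update U ℓ v) p.1 p.2.1.1 p.2.1.2) ∂(haarProbability G)) with hρ
  have hwm : Measurable fun U => (ρ U)⁻¹ := hρm.inv
  have hw0' : ∀ U, 0 < (ρ U)⁻¹ := fun U => inv_pos.2 (hρpos U)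
  have hπ' : (q.withDensity fun U => ENNReal.ofReal (ρ U)⁻¹) = π := withDensity_inv_density hρm hρpos hρq
  haveI : IsProbabilityMeasure (q.withDensity fun U => ENNReal.ofReal (ρ U)⁻¹) := by rw [hπ']; infer_instance
  have hone : ∫⁻ y, ENNReal.ofReal (ρ y)⁻¹ ∂q = ENNReal.ofReal 1 := by
    have h : π Set.univ = 1 := measure_univ
    rw [← hπ', withDensity_apply _ MeasurableSet.univ, Measure.restrict_univ] at h
    rw [h, ENNReal.ofReal_one]
  have hA' := imhAcceptMass_toReal_eq_of_forall_le (q := q) hw0' cold hmax zero_le_one hone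
  have hrate : ((ρ cold)⁻¹)⁻¹ = (∫ V, ∏ p : Plaquette d L, w (plaquetteHolonomy V p.1 p.2.1.1 p.2.1.2) ∂(Measure.pi fun _ : Edge d L => haarProbability G)) /
        ∏ ℓ ∈ T, ∫ h, w h ^ (C ℓ).card ∂(haarProbability G) := by
    rw [← hA, hA', one_div]
  have hrate' : (ρ cold)⁻¹ = ((∫ V, ∏ p : Plaquette d L, w (plaquetteHolonomy V p.1 p.2.1.1 p.2.1.2) ∂(Measure.pi fun _ : Edge d L => haarProbability G)) /
        ∏ ℓ ∈ T, ∫ h, w h ^ (C ℓ).card ∂(haarProbability G))⁻¹ := by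
    rw [← hrate, inv_inv]
  have hf' : Integrable f (q.withDensity fun U => ENNReal.ofReal (ρ U)⁻¹) := by rw [hπ']; exact hf
  have hfx' : f cold ≠ ∫ U, f U ∂(q.withDensity fun U => ENNReal.ofReal (ρ U)⁻¹) := by rw [hπ']; exact hfx
  have hbias' := hbias
  rw [← hπ'] at hbias'
  have h := weight_le_of_sum_bias_mode_le (q := q) hwm hw0' hmax hN hf' hfx' hbias'
  rw [hrate'] at h
  exact h

end Summit.Ventures.LatticeQCDFlow.Theory2.Autoregressive

end
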